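import Summits.NavierStokesRegularity.NavierStokesRegularity.Theorems.EfficiencyFloorNearSaturationNearMaximiserSeqCorePythagoras
import HarnessLib

/-!
# Route `EfficiencyFloor`, crux `NearSaturationNearMaximiser` (stmt-NavierStokesRegularity-25482) on the
# `ProductionEfficiencyDecay` ladder (stmt-22866): the TRILINEAR EXPANSION of the stretching and the splitting clause

Def-free helper file, fourth of the group `…SeqCoreUpgrade` (p841029) / `…SeqCoreCentring` (p841053) / `…SeqCorePythagoras`
(p841077). The remaining hypothesis (P_w) there contains the SPLITTING clause `S(u_k − w) → c⋆ − S(w)` for the cubic stretching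
`S(v) = ∫⟪curl v, Dv (curl v)⟫`. Writing `T(a,b,c) = ∫⟪curl a, Db (curl c)⟫` (trilinear) and `r = u − w`, this file PROVES the
exact expansion `S(u) = S(w) + S(r) + [T(r,w,w) + T(w,r,w) + T(w,w,r)] + [T(r,r,w) + T(r,w,r) + T(w,r,r)]` for admissible `u, w`
(all eight terms integrable, by the trilinear Hölder bound of `…SeqCoreStretching`), and hence reduces the splitting clause to
«the six MIXED terms tend to zero» along the sequence — the three terms linear in `r_k` by weak convergence (`r_k ⇀ 0` tested on
fixed `L²` fields built from `w`), the three quadratic ones by local compactness (Brezis–Lieb mechanism):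

* `mixed_integrable` — `x ↦ ⟪curl a x, Db(x) (curl c x)⟫` is integrable for admissible `a, b, c`;
* `stretching_expand` — the eight-term expansion of `S(u)` around `w` with `r = u − w`;
* `stretching_splitting_of_mixed` — if `S(u_k) → c` and the six mixed terms of `(u_k − w, w)` tend to `0`, then
  `S(u_k − w) → c − S(w)` (the splitting clause of (P_w));
* `compact_of_centredLocalWeakLimitMixed`, `nearSaturationNearMaximiser_of_centredLocalWeakLimitMixed` — BY NAME: stmt-25482 ⟸
  (P_w') = (P_w) with the splitting clause replaced by «the six mixed trilinear terms → 0».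

HONEST FRAMING: the vanishing of the mixed terms (weak convergence + local compactness) is NOT proved here; stmt-25482,
`LerayFloorGap`, `ProductionEfficiencyDecay` (stmt-22866) and Navier–Stokes regularity stay OPEN; no summit statement is proved. [folklore]
-/

-- the problem directory repeats the summit name (`NavierStokesRegularity/NavierStokesRegularity`)
set_option linter.dupNamespace false

noncomputable section

namespace Summit.NavierStokesRegularity.NavierStokesRegularity.Theorems

namespace NearSaturationNearMaximiser

namespace SeqCore

open Set MeasureTheory Filter Topology Function
open scoped InnerProductSpace ENNReal
open Literature.Analysis.FluidPDE

/-- **Mixed stretching terms are integrable**: for admissible `a, b, c` (smooth, `D¹, D² ∈ L²`),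
`x ↦ ⟪curl a x, Db(x)(curl c x)⟫` is integrable (`|⟪f, A g⟫| ≤ ‖f‖‖g‖‖A‖`, `‖curl ·‖⁴ ∈ L¹`, `‖D·‖² ∈ L¹`). [folklore] -/
theorem mixed_integrable {a b c : EuclideanSpace ℝ (Fin 3) → EuclideanSpace ℝ (Fin 3)}
    (ha : ContDiff ℝ (⊤ : ℕ∞) a) (ha1 : ∫⁻ x, ‖iteratedFDeriv ℝ 1 a x‖ₑ ^ 2 < ⊤) (ha2 : ∫⁻ x, ‖iteratedFDeriv ℝ 2 a x‖ₑ ^ 2 < ⊤)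
    (hb : ContDiff ℝ (⊤ : ℕ∞) b) (hb1 : ∫⁻ x, ‖iteratedFDeriv ℝ 1 b x‖ₑ ^ 2 < ⊤) (hb2 : ∫⁻ x, ‖iteratedFDeriv ℝ 2 b x‖ₑ ^ 2 < ⊤)
    (hc : ContDiff ℝ (⊤ : ℕ∞) c) (hc1 : ∫⁻ x, ‖iteratedFDeriv ℝ 1 c x‖ₑ ^ 2 < ⊤) (hc2 : ∫⁻ x, ‖iteratedFDeriv ℝ 2 c x‖ₑ ^ 2 < ⊤) :
    Integrable (fun x => ⟪curl a x, fderiv ℝ b x (curl c x)⟫_ℝ) := by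
  obtain ⟨Ia4, -, -⟩ := stretch_integrable ha ha1 ha2
  obtain ⟨-, IDb, -⟩ := stretch_integrable hb hb1 hb2
  obtain ⟨Ic4, -, -⟩ := stretch_integrable hc hc1 hc2
  have hac : Continuous (curl a) := (contDiff_curl (n := 1) (ha.of_le (by norm_cast))).continuous
  have hcc : Continuous (curl c) := (contDiff_curl (n := 1) (hc.of_le (by norm_cast))).continuous
  have hDb : Continuous (fderiv ℝ b) := (hb.of_le (by norm_cast) : ContDiff ℝ 1 b).continuous_fderiv one_ne_zero
  have hI := (integral_norm_mul_norm_mul_norm_le hac hcc hDb Ia4 Ic4 IDb).1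
  refine hI.mono' (hac.inner (hDb.clm_apply hcc)).aestronglyMeasurable (ae_of_all _ fun x => ?_)
  rw [Real.norm_eq_abs]
  exact abs_inner_apply_le _ _ _

/-- Pointwise eight-term expansion of `⟪θ + ρ, (B + R)(θ + ρ)⟫`. [folklore] -/
theorem inner_stretch_expand (θ ρ : EuclideanSpace ℝ (Fin 3)) (B R : EuclideanSpace ℝ (Fin 3) →L[ℝ] EuclideanSpace ℝ (Fin 3)) :
    ⟪θ + ρ, (B + R) (θ + ρ)⟫_ℝ =
      ⟪θ, B θ⟫_ℝ + ⟪ρ, R ρ⟫_ℝ + (⟪ρ, B θ⟫_ℝ + ⟪θ, R θ⟫_ℝ + ⟪θ, B ρ⟫_ℝ) + (⟪ρ, R θ⟫_ℝ + ⟪ρ, B ρ⟫_ℝ + ⟪θ, R ρ⟫_ℝ) := by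
  simp only [add_apply, map_add, inner_add_left, inner_add_right]
  ring

/-- **Trilinear expansion of the stretching around a profile.** For admissible `u, w` and `r = u − w` (pointwise `curl u = curl w +
curl r`, `Du = Dw + Dr`): `S(u) = S(w) + S(r) + [T(r,w,w) + T(w,r,w) + T(w,w,r)] + [T(r,r,w) + T(r,w,r) + T(w,r,r)]`,
`T(a,b,c) = ∫⟪curl a, Db (curl c)⟫`. [folklore] -/
theorem stretching_expand {u w : EuclideanSpace ℝ (Fin 3) → EuclideanSpace ℝ (Fin 3)}
    (hu : ContDiff ℝ (⊤ : ℕ∞) u ∧ VectorCalculus.IsDivFree u ∧ (∫⁻ x, ‖iteratedFDeriv ℝ 0 u x‖ₑ ^ 2 < ⊤) ∧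
      (∫⁻ x, ‖iteratedFDeriv ℝ 1 u x‖ₑ ^ 2 < ⊤) ∧ (∫⁻ x, ‖iteratedFDeriv ℝ 2 u x‖ₑ ^ 2 < ⊤))
    (hw : ContDiff ℝ (⊤ : ℕ∞) w ∧ VectorCalculus.IsDivFree w ∧ (∫⁻ x, ‖iteratedFDeriv ℝ 0 w x‖ₑ ^ 2 < ⊤) ∧
      (∫⁻ x, ‖iteratedFDeriv ℝ 1 w x‖ₑ ^ 2 < ⊤) ∧ (∫⁻ x, ‖iteratedFDeriv ℝ 2 w x‖ₑ ^ 2 < ⊤)) :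
    (∫ x, ⟪curl u x, fderiv ℝ u x (curl u x)⟫_ℝ) =
      (∫ x, ⟪curl w x, fderiv ℝ w x (curl w x)⟫_ℝ) + (∫ x, ⟪curl (u - w) x, fderiv ℝ (u - w) x (curl (u - w) x)⟫_ℝ) +
      ((∫ x, ⟪curl (u - w) x, fderiv ℝ w x (curl w x)⟫_ℝ) + (∫ x, ⟪curl w x, fderiv ℝ (u - w) x (curl w x)⟫_ℝ) +
        (∫ x, ⟪curl w x, fderiv ℝ w x (curl (u - w) x)⟫_ℝ)) +
      ((∫ x, ⟪curl (u - w) x, fderiv ℝ (u - w) x (curl w x)⟫_ℝ) + (∫ x, ⟪curl (u - w) x, fderiv ℝ w x (curl (u - w) x)⟫_ℝ) +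
        (∫ x, ⟪curl w x, fderiv ℝ (u - w) x (curl (u - w) x)⟫_ℝ)) := by
  have hr := admissible_sub hu hw
  set r : EuclideanSpace ℝ (Fin 3) → EuclideanSpace ℝ (Fin 3) := u - w with hrdef
  -- pointwise: `curl u = curl w + curl r`, `Du = Dw + Dr`
  have hud : Differentiable ℝ u := hu.1.differentiable (by simp)
  have hwd : Differentiable ℝ w := hw.1.differentiable (by simp)
  have hcurl : ∀ x, curl u x = curl w x + curl r x := fun x => by
    have h := congrFun (curl_sub_eq hud hwd) x
    rw [← hrdef] at h
    rw [h]; abel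
  have hfd : ∀ x, fderiv ℝ u x = fderiv ℝ w x + fderiv ℝ r x := fun x => by
    have h : fderiv ℝ r x = fderiv ℝ u x - fderiv ℝ w x := by
      rw [hrdef]; exact fderiv_sub (hud x) (hwd x)
    rw [h]; abel
  have hpt : ∀ x, ⟪curl u x, fderiv ℝ u x (curl u x)⟫_ℝ =
      ⟪curl w x, fderiv ℝ w x (curl w x)⟫_ℝ + ⟪curl r x, fderiv ℝ r x (curl r x)⟫_ℝ +
      (⟪curl r x, fderiv ℝ w x (curl w x)⟫_ℝ + ⟪curl w x, fderiv ℝ r x (curl w x)⟫_ℝ + ⟪curl w x, fderiv ℝ w x (curl r x)⟫_ℝ) +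
      (⟪curl r x, fderiv ℝ r x (curl w x)⟫_ℝ + ⟪curl r x, fderiv ℝ w x (curl r x)⟫_ℝ + ⟪curl w x, fderiv ℝ r x (curl r x)⟫_ℝ) :=
    fun x => by rw [hcurl x, hfd x]; exact inner_stretch_expand _ _ _ _
  -- the eight integrands
  set T1 : EuclideanSpace ℝ (Fin 3) → ℝ := fun x => ⟪curl w x, fderiv ℝ w x (curl w x)⟫_ℝ with hT1
  set T2 : EuclideanSpace ℝ (Fin 3) → ℝ := fun x => ⟪curl r x, fderiv ℝ r x (curl r x)⟫_ℝ with hT2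
  set T3 : EuclideanSpace ℝ (Fin 3) → ℝ := fun x => ⟪curl r x, fderiv ℝ w x (curl w x)⟫_ℝ with hT3
  set T4 : EuclideanSpace ℝ (Fin 3) → ℝ := fun x => ⟪curl w x, fderiv ℝ r x (curl w x)⟫_ℝ with hT4
  set T5 : EuclideanSpace ℝ (Fin 3) → ℝ := fun x => ⟪curl w x, fderiv ℝ w x (curl r x)⟫_ℝ with hT5
  set T6 : EuclideanSpace ℝ (Fin 3) → ℝ := fun x => ⟪curl r x, fderiv ℝ r x (curl w x)⟫_ℝ with hT6
  set T7 : EuclideanSpace ℝ (Fin 3) → ℝ := fun x => ⟪curl r x, fderiv ℝ w x (curl r x)⟫_ℝ with hT7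
  set T8 : EuclideanSpace ℝ (Fin 3) → ℝ := fun x => ⟪curl w x, fderiv ℝ r x (curl r x)⟫_ℝ with hT8
  have hpt' : ∀ x, ⟪curl u x, fderiv ℝ u x (curl u x)⟫_ℝ =
      T1 x + T2 x + (T3 x + T4 x + T5 x) + (T6 x + T7 x + T8 x) := fun x => by
    simp only [hT1, hT2, hT3, hT4, hT5, hT6, hT7, hT8]
    exact hpt x
  -- integrability of the eight terms
  have I := fun {a b c : EuclideanSpace ℝ (Fin 3) → EuclideanSpace ℝ (Fin 3)}
    (ha : ContDiff ℝ (⊤ : ℕ∞) a ∧ VectorCalculus.IsDivFree a ∧ (∫⁻ x, ‖iteratedFDeriv ℝ 0 a x‖ₑ ^ 2 < ⊤) ∧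
      (∫⁻ x, ‖iteratedFDeriv ℝ 1 a x‖ₑ ^ 2 < ⊤) ∧ (∫⁻ x, ‖iteratedFDeriv ℝ 2 a x‖ₑ ^ 2 < ⊤))
    (hb : ContDiff ℝ (⊤ : ℕ∞) b ∧ VectorCalculus.IsDivFree b ∧ (∫⁻ x, ‖iteratedFDeriv ℝ 0 b x‖ₑ ^ 2 < ⊤) ∧
      (∫⁻ x, ‖iteratedFDeriv ℝ 1 b x‖ₑ ^ 2 < ⊤) ∧ (∫⁻ x, ‖iteratedFDeriv ℝ 2 b x‖ₑ ^ 2 < ⊤))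
    (hc : ContDiff ℝ (⊤ : ℕ∞) c ∧ VectorCalculus.IsDivFree c ∧ (∫⁻ x, ‖iteratedFDeriv ℝ 0 c x‖ₑ ^ 2 < ⊤) ∧
      (∫⁻ x, ‖iteratedFDeriv ℝ 1 c x‖ₑ ^ 2 < ⊤) ∧ (∫⁻ x, ‖iteratedFDeriv ℝ 2 c x‖ₑ ^ 2 < ⊤)) =>
    mixed_integrable ha.1 ha.2.2.2.1 ha.2.2.2.2 hb.1 hb.2.2.2.1 hb.2.2.2.2 hc.1 hc.2.2.2.1 hc.2.2.2.2
  have I1 : Integrable T1 := I hw hw hw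
  have I2 : Integrable T2 := I hr hr hr
  have I3 : Integrable T3 := I hr hw hw
  have I4 : Integrable T4 := I hw hr hw
  have I5 : Integrable T5 := I hw hw hr
  have I6 : Integrable T6 := I hr hr hw
  have I7 : Integrable T7 := I hr hw hr
  have I8 : Integrable T8 := I hw hr hr
  rw [integral_congr_ae (Eventually.of_forall hpt')]
  have A1 : (∫ x, T1 x + T2 x + (T3 x + T4 x + T5 x) + (T6 x + T7 x + T8 x)) =
      (∫ x, T1 x + T2 x + (T3 x + T4 x + T5 x)) + ∫ x, T6 x + T7 x + T8 x :=
    integral_add ((I1.add I2).add ((I3.add I4).add I5)) ((I6.add I7).add I8)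
  have A2 : (∫ x, T1 x + T2 x + (T3 x + T4 x + T5 x)) = (∫ x, T1 x + T2 x) + ∫ x, T3 x + T4 x + T5 x :=
    integral_add (I1.add I2) ((I3.add I4).add I5)
  have A3 : (∫ x, T1 x + T2 x) = (∫ x, T1 x) + ∫ x, T2 x := integral_add I1 I2
  have A4 : (∫ x, T3 x + T4 x + T5 x) = (∫ x, T3 x + T4 x) + ∫ x, T5 x := integral_add (I3.add I4) I5
  have A5 : (∫ x, T3 x + T4 x) = (∫ x, T3 x) + ∫ x, T4 x := integral_add I3 I4
  have A6 : (∫ x, T6 x + T7 x + T8 x) = (∫ x, T6 x + T7 x) + ∫ x, T8 x := integral_add (I6.add I7) I8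
  have A7 : (∫ x, T6 x + T7 x) = (∫ x, T6 x) + ∫ x, T7 x := integral_add I6 I7
  rw [A1, A2, A3, A4, A5, A6, A7]

/-- **The splitting clause from the vanishing of the mixed terms.** Along admissible `u_k` and an admissible `w`, if
`S(u_k) → c` and the six mixed trilinear terms of `(u_k − w, w)` tend to `0`, then `S(u_k − w) → c − S(w)`. [folklore] -/
theorem stretching_splitting_of_mixed {u : ℕ → EuclideanSpace ℝ (Fin 3) → EuclideanSpace ℝ (Fin 3)}
    {w : EuclideanSpace ℝ (Fin 3) → EuclideanSpace ℝ (Fin 3)} {c : ℝ}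
    (hu : ∀ k, ContDiff ℝ (⊤ : ℕ∞) (u k) ∧ VectorCalculus.IsDivFree (u k) ∧ (∫⁻ x, ‖iteratedFDeriv ℝ 0 (u k) x‖ₑ ^ 2 < ⊤) ∧
      (∫⁻ x, ‖iteratedFDeriv ℝ 1 (u k) x‖ₑ ^ 2 < ⊤) ∧ (∫⁻ x, ‖iteratedFDeriv ℝ 2 (u k) x‖ₑ ^ 2 < ⊤))
    (hw : ContDiff ℝ (⊤ : ℕ∞) w ∧ VectorCalculus.IsDivFree w ∧ (∫⁻ x, ‖iteratedFDeriv ℝ 0 w x‖ₑ ^ 2 < ⊤) ∧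
      (∫⁻ x, ‖iteratedFDeriv ℝ 1 w x‖ₑ ^ 2 < ⊤) ∧ (∫⁻ x, ‖iteratedFDeriv ℝ 2 w x‖ₑ ^ 2 < ⊤))
    (hS : Tendsto (fun k => ∫ x, ⟪curl (u k) x, fderiv ℝ (u k) x (curl (u k) x)⟫_ℝ) atTop (𝓝 c))
    (hlin : Tendsto (fun k => (∫ x, ⟪curl (u k - w) x, fderiv ℝ w x (curl w x)⟫_ℝ) +
      (∫ x, ⟪curl w x, fderiv ℝ (u k - w) x (curl w x)⟫_ℝ) + (∫ x, ⟪curl w x, fderiv ℝ w x (curl (u k - w) x)⟫_ℝ)) atTop (𝓝 0))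
    (hquad : Tendsto (fun k => (∫ x, ⟪curl (u k - w) x, fderiv ℝ (u k - w) x (curl w x)⟫_ℝ) +
      (∫ x, ⟪curl (u k - w) x, fderiv ℝ w x (curl (u k - w) x)⟫_ℝ) +
      (∫ x, ⟪curl w x, fderiv ℝ (u k - w) x (curl (u k - w) x)⟫_ℝ)) atTop (𝓝 0)) :
    Tendsto (fun k => ∫ x, ⟪curl (u k - w) x, fderiv ℝ (u k - w) x (curl (u k - w) x)⟫_ℝ) atTop
      (𝓝 (c - ∫ x, ⟪curl w x, fderiv ℝ w x (curl w x)⟫_ℝ)) := by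
  have heq : ∀ k, (∫ x, ⟪curl (u k - w) x, fderiv ℝ (u k - w) x (curl (u k - w) x)⟫_ℝ) =
      (∫ x, ⟪curl (u k) x, fderiv ℝ (u k) x (curl (u k) x)⟫_ℝ) - (∫ x, ⟪curl w x, fderiv ℝ w x (curl w x)⟫_ℝ) -
      ((∫ x, ⟪curl (u k - w) x, fderiv ℝ w x (curl w x)⟫_ℝ) + (∫ x, ⟪curl w x, fderiv ℝ (u k - w) x (curl w x)⟫_ℝ) +
        (∫ x, ⟪curl w x, fderiv ℝ w x (curl (u k - w) x)⟫_ℝ)) -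
      ((∫ x, ⟪curl (u k - w) x, fderiv ℝ (u k - w) x (curl w x)⟫_ℝ) + (∫ x, ⟪curl (u k - w) x, fderiv ℝ w x (curl (u k - w) x)⟫_ℝ) +
        (∫ x, ⟪curl w x, fderiv ℝ (u k - w) x (curl (u k - w) x)⟫_ℝ)) := fun k => by
    rw [stretching_expand (hu k) hw]; ring
  have hlim := ((hS.sub_const (∫ x, ⟪curl w x, fderiv ℝ w x (curl w x)⟫_ℝ)).sub hlin).sub hquad
  rw [sub_zero, sub_zero] at hlim
  exact hlim.congr fun k => (heq k).symm

/-! ## By name: compactness from centred local weak limits with vanishing mixed terms -/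

/-- **COMPACTNESS from centred local weak limits with vanishing mixed terms.** As `compact_of_centredLocalWeakLimit`
(`…SeqCorePythagoras`), with the splitting clause `S(v_{φ k} − w) → c − S(w)` replaced by the vanishing of the three LINEAR and
the three QUADRATIC mixed trilinear terms of `(v_{φ k} − w, w)` (`stretching_splitting_of_mixed`). [folklore] -/
theorem compact_of_centredLocalWeakLimitMixed {c : ℝ} (hc : 0 < c)
    (hadm : ∀ f : EuclideanSpace ℝ (Fin 3) → EuclideanSpace ℝ (Fin 3), (ContDiff ℝ (⊤ : ℕ∞) f ∧
      Literature.Analysis.FluidPDE.VectorCalculus.IsDivFree f ∧ (∫⁻ x, ‖iteratedFDeriv ℝ 0 f x‖ₑ ^ 2 < ⊤) ∧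
      (∫⁻ x, ‖iteratedFDeriv ℝ 1 f x‖ₑ ^ 2 < ⊤) ∧ (∫⁻ x, ‖iteratedFDeriv ℝ 2 f x‖ₑ ^ 2 < ⊤)) → (∫ x,
      ⟪Literature.Analysis.FluidPDE.curl f x, fderiv ℝ f x (Literature.Analysis.FluidPDE.curl f x)⟫_ℝ) ≤ c *
      (∫ x, ‖Literature.Analysis.FluidPDE.curl f x‖ ^ 2) ^ (3 / 4 : ℝ) * (∫ x,
      Literature.Analysis.FluidPDE.frobeniusNormSq (fderiv ℝ (Literature.Analysis.FluidPDE.curl f) x)) ^ (3 / 4 : ℝ))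
    (HWm : ∀ K δ : ℝ, 0 < K → 0 < δ → ∀ v : ℕ → EuclideanSpace ℝ (Fin 3) → EuclideanSpace ℝ (Fin 3),
      (∀ n, (ContDiff ℝ (⊤ : ℕ∞) (v n) ∧
      Literature.Analysis.FluidPDE.VectorCalculus.IsDivFree (v n) ∧ (∫⁻ x, ‖iteratedFDeriv ℝ 0 (v n) x‖ₑ ^ 2 < ⊤) ∧
      (∫⁻ x, ‖iteratedFDeriv ℝ 1 (v n) x‖ₑ ^ 2 < ⊤) ∧ (∫⁻ x, ‖iteratedFDeriv ℝ 2 (v n) x‖ₑ ^ 2 < ⊤))) →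
      (∀ n, (∫ x, ‖Literature.Analysis.FluidPDE.curl (v n) x‖ ^ 2) = 1) →
      (∀ n, (∫ x, Literature.Analysis.FluidPDE.frobeniusNormSq (fderiv ℝ (Literature.Analysis.FluidPDE.curl (v n)) x)) = 1) →
      Tendsto (fun n => ∫ x, ⟪Literature.Analysis.FluidPDE.curl (v n) x, fderiv ℝ (v n) x
        (Literature.Analysis.FluidPDE.curl (v n) x)⟫_ℝ) atTop (𝓝 c) →
      (∀ᶠ n in atTop, δ ≤ ∫ x in Metric.ball (0 : EuclideanSpace ℝ (Fin 3)) K, ‖Literature.Analysis.FluidPDE.curl (v n) x‖ ^ 2) →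
      ∃ w : EuclideanSpace ℝ (Fin 3) → EuclideanSpace ℝ (Fin 3), (ContDiff ℝ (⊤ : ℕ∞) w ∧
      Literature.Analysis.FluidPDE.VectorCalculus.IsDivFree w ∧ (∫⁻ x, ‖iteratedFDeriv ℝ 0 w x‖ₑ ^ 2 < ⊤) ∧
      (∫⁻ x, ‖iteratedFDeriv ℝ 1 w x‖ₑ ^ 2 < ⊤) ∧ (∫⁻ x, ‖iteratedFDeriv ℝ 2 w x‖ₑ ^ 2 < ⊤)) ∧
        ∃ φ : ℕ → ℕ, StrictMono φ ∧
        Tendsto (fun k => ∫ x in Metric.ball (0 : EuclideanSpace ℝ (Fin 3)) K,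
          ‖Literature.Analysis.FluidPDE.curl (v (φ k) - w) x‖ ^ 2) atTop (𝓝 0) ∧
        Tendsto (fun k => ∫ x, ⟪Literature.Analysis.FluidPDE.curl (v (φ k)) x, Literature.Analysis.FluidPDE.curl w x⟫_ℝ)
          atTop (𝓝 (∫ x, ‖Literature.Analysis.FluidPDE.curl w x‖ ^ 2)) ∧
        Tendsto (fun k => ∫ x, ∑ i, ⟪fderiv ℝ (Literature.Analysis.FluidPDE.curl (v (φ k))) x (EuclideanSpace.basisFun (Fin 3) ℝ i),
          fderiv ℝ (Literature.Analysis.FluidPDE.curl w) x (EuclideanSpace.basisFun (Fin 3) ℝ i)⟫_ℝ) atTop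
          (𝓝 (∫ x, Literature.Analysis.FluidPDE.frobeniusNormSq (fderiv ℝ (Literature.Analysis.FluidPDE.curl w) x))) ∧
        Tendsto (fun k => (∫ x, ⟪Literature.Analysis.FluidPDE.curl (v (φ k) - w) x, fderiv ℝ w x (Literature.Analysis.FluidPDE.curl w x)⟫_ℝ) +
          (∫ x, ⟪Literature.Analysis.FluidPDE.curl w x, fderiv ℝ (v (φ k) - w) x (Literature.Analysis.FluidPDE.curl w x)⟫_ℝ) +
          (∫ x, ⟪Literature.Analysis.FluidPDE.curl w x, fderiv ℝ w x (Literature.Analysis.FluidPDE.curl (v (φ k) - w) x)⟫_ℝ)) atTop (𝓝 0) ∧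
        Tendsto (fun k => (∫ x, ⟪Literature.Analysis.FluidPDE.curl (v (φ k) - w) x, fderiv ℝ (v (φ k) - w) x (Literature.Analysis.FluidPDE.curl w x)⟫_ℝ) +
          (∫ x, ⟪Literature.Analysis.FluidPDE.curl (v (φ k) - w) x, fderiv ℝ w x (Literature.Analysis.FluidPDE.curl (v (φ k) - w) x)⟫_ℝ) +
          (∫ x, ⟪Literature.Analysis.FluidPDE.curl w x, fderiv ℝ (v (φ k) - w) x (Literature.Analysis.FluidPDE.curl (v (φ k) - w) x)⟫_ℝ)) atTop (𝓝 0)) :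
    ∀ v : ℕ → EuclideanSpace ℝ (Fin 3) → EuclideanSpace ℝ (Fin 3),
      (∀ n, (ContDiff ℝ (⊤ : ℕ∞) (v n) ∧
      Literature.Analysis.FluidPDE.VectorCalculus.IsDivFree (v n) ∧ (∫⁻ x, ‖iteratedFDeriv ℝ 0 (v n) x‖ₑ ^ 2 < ⊤) ∧
      (∫⁻ x, ‖iteratedFDeriv ℝ 1 (v n) x‖ₑ ^ 2 < ⊤) ∧ (∫⁻ x, ‖iteratedFDeriv ℝ 2 (v n) x‖ₑ ^ 2 < ⊤))) →
      (∀ n, (∫ x, ‖Literature.Analysis.FluidPDE.curl (v n) x‖ ^ 2) = 1) →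
      (∀ n, (∫ x, Literature.Analysis.FluidPDE.frobeniusNormSq (fderiv ℝ (Literature.Analysis.FluidPDE.curl (v n)) x)) = 1) →
      Tendsto (fun n => ∫ x, ⟪Literature.Analysis.FluidPDE.curl (v n) x, fderiv ℝ (v n) x
        (Literature.Analysis.FluidPDE.curl (v n) x)⟫_ℝ) atTop (𝓝 c) →
      ∃ w : EuclideanSpace ℝ (Fin 3) → EuclideanSpace ℝ (Fin 3), (ContDiff ℝ (⊤ : ℕ∞) w ∧
      Literature.Analysis.FluidPDE.VectorCalculus.IsDivFree w ∧ (∫⁻ x, ‖iteratedFDeriv ℝ 0 w x‖ₑ ^ 2 < ⊤) ∧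
      (∫⁻ x, ‖iteratedFDeriv ℝ 1 w x‖ₑ ^ 2 < ⊤) ∧ (∫⁻ x, ‖iteratedFDeriv ℝ 2 w x‖ₑ ^ 2 < ⊤)) ∧
        ∃ (a : ℕ → EuclideanSpace ℝ (Fin 3)) (φ : ℕ → ℕ), StrictMono φ ∧
        Tendsto (fun k => ∫ x, ‖Literature.Analysis.FluidPDE.curl ((fun x => v (φ k) (x - a k)) - w) x‖ ^ 2) atTop (𝓝 0) ∧
        Tendsto (fun k => ∫ x, Literature.Analysis.FluidPDE.frobeniusNormSq (fderiv ℝ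
          (Literature.Analysis.FluidPDE.curl ((fun x => v (φ k) (x - a k)) - w)) x)) atTop (𝓝 0) := by
  refine compact_of_centredLocalWeakLimit hc hadm fun K δ hK hδ v hAdm hZ1 hP1 hS hcen => ?_
  obtain ⟨w, hw, φ, hφ, hloc, hpZ, hpP, hlin, hquad⟩ := HWm K δ hK hδ v hAdm hZ1 hP1 hS hcen
  exact ⟨w, hw, φ, hφ, hloc, hpZ, hpP,
    stretching_splitting_of_mixed (fun k => hAdm (φ k)) hw (hS.comp hφ.tendsto_atTop) hlin hquad⟩

/-- **`NearSaturationNearMaximiser` (stmt-25482) from centred local weak limits with vanishing mixed terms, BY NAME.**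
Assumed, for the sharp constant: (P_w') — every centred admissible sequence with `Z = Pal = 1`, `S → c⋆` has a subsequence and an
ADMISSIBLE `w` with local `L²` convergence of the vorticity on the centring ball (Rellich), weak convergence of `curl`, `D curl`
tested on `w` (Banach–Alaoglu), and the six mixed trilinear stretching terms of `(v_{φ k} − w, w)` tending to `0` (three linear:
weak convergence against fixed `L²` fields built from `w`; three quadratic: local compactness + tails of `w`). Proved in this group
of files: non-vanishing, asymptotic Pythagoras, the trilinear expansion, the upgrade, the sequential core, the item. NOT proved: (P_w'). [folklore] -/
theorem nearSaturationNearMaximiser_of_centredLocalWeakLimitMixed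
    (HWm : ∀ c : ℝ, (0 < c ∧ (∀ v : EuclideanSpace ℝ (Fin 3) → EuclideanSpace ℝ (Fin 3), (ContDiff ℝ (⊤ : ℕ∞) v ∧
      Literature.Analysis.FluidPDE.VectorCalculus.IsDivFree v ∧ (∫⁻ x, ‖iteratedFDeriv ℝ 0 v x‖ₑ ^ 2 < ⊤) ∧
      (∫⁻ x, ‖iteratedFDeriv ℝ 1 v x‖ₑ ^ 2 < ⊤) ∧ (∫⁻ x, ‖iteratedFDeriv ℝ 2 v x‖ₑ ^ 2 < ⊤)) → (∫ x,
      ⟪Literature.Analysis.FluidPDE.curl v x, fderiv ℝ v x (Literature.Analysis.FluidPDE.curl v x)⟫_ℝ) ≤ c *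
      (∫ x, ‖Literature.Analysis.FluidPDE.curl v x‖ ^ 2) ^ (3 / 4 : ℝ) * (∫ x,
      Literature.Analysis.FluidPDE.frobeniusNormSq (fderiv ℝ (Literature.Analysis.FluidPDE.curl v) x)) ^ (3 / 4 : ℝ)) ∧ ∀ c' : ℝ, (∀ w : EuclideanSpace ℝ (Fin 3) → EuclideanSpace ℝ (Fin 3), (ContDiff ℝ (⊤ : ℕ∞) w ∧
      Literature.Analysis.FluidPDE.VectorCalculus.IsDivFree w ∧ (∫⁻ x, ‖iteratedFDeriv ℝ 0 w x‖ₑ ^ 2 < ⊤) ∧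
      (∫⁻ x, ‖iteratedFDeriv ℝ 1 w x‖ₑ ^ 2 < ⊤) ∧ (∫⁻ x, ‖iteratedFDeriv ℝ 2 w x‖ₑ ^ 2 < ⊤)) → (∫ x,
      ⟪Literature.Analysis.FluidPDE.curl w x, fderiv ℝ w x (Literature.Analysis.FluidPDE.curl w x)⟫_ℝ) ≤ c' *
      (∫ x, ‖Literature.Analysis.FluidPDE.curl w x‖ ^ 2) ^ (3 / 4 : ℝ) * (∫ x,
      Literature.Analysis.FluidPDE.frobeniusNormSq (fderiv ℝ (Literature.Analysis.FluidPDE.curl w) x)) ^ (3 / 4 : ℝ)) → c ≤ c') →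
      ∀ K δ : ℝ, 0 < K → 0 < δ → ∀ v : ℕ → EuclideanSpace ℝ (Fin 3) → EuclideanSpace ℝ (Fin 3),
      (∀ n, (ContDiff ℝ (⊤ : ℕ∞) (v n) ∧
      Literature.Analysis.FluidPDE.VectorCalculus.IsDivFree (v n) ∧ (∫⁻ x, ‖iteratedFDeriv ℝ 0 (v n) x‖ₑ ^ 2 < ⊤) ∧
      (∫⁻ x, ‖iteratedFDeriv ℝ 1 (v n) x‖ₑ ^ 2 < ⊤) ∧ (∫⁻ x, ‖iteratedFDeriv ℝ 2 (v n) x‖ₑ ^ 2 < ⊤))) →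
      (∀ n, (∫ x, ‖Literature.Analysis.FluidPDE.curl (v n) x‖ ^ 2) = 1) →
      (∀ n, (∫ x, Literature.Analysis.FluidPDE.frobeniusNormSq (fderiv ℝ (Literature.Analysis.FluidPDE.curl (v n)) x)) = 1) →
      Tendsto (fun n => ∫ x, ⟪Literature.Analysis.FluidPDE.curl (v n) x, fderiv ℝ (v n) x
        (Literature.Analysis.FluidPDE.curl (v n) x)⟫_ℝ) atTop (𝓝 c) →
      (∀ᶠ n in atTop, δ ≤ ∫ x in Metric.ball (0 : EuclideanSpace ℝ (Fin 3)) K, ‖Literature.Analysis.FluidPDE.curl (v n) x‖ ^ 2) →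
      ∃ w : EuclideanSpace ℝ (Fin 3) → EuclideanSpace ℝ (Fin 3), (ContDiff ℝ (⊤ : ℕ∞) w ∧
      Literature.Analysis.FluidPDE.VectorCalculus.IsDivFree w ∧ (∫⁻ x, ‖iteratedFDeriv ℝ 0 w x‖ₑ ^ 2 < ⊤) ∧
      (∫⁻ x, ‖iteratedFDeriv ℝ 1 w x‖ₑ ^ 2 < ⊤) ∧ (∫⁻ x, ‖iteratedFDeriv ℝ 2 w x‖ₑ ^ 2 < ⊤)) ∧
        ∃ φ : ℕ → ℕ, StrictMono φ ∧
        Tendsto (fun k => ∫ x in Metric.ball (0 : EuclideanSpace ℝ (Fin 3)) K,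
          ‖Literature.Analysis.FluidPDE.curl (v (φ k) - w) x‖ ^ 2) atTop (𝓝 0) ∧
        Tendsto (fun k => ∫ x, ⟪Literature.Analysis.FluidPDE.curl (v (φ k)) x, Literature.Analysis.FluidPDE.curl w x⟫_ℝ)
          atTop (𝓝 (∫ x, ‖Literature.Analysis.FluidPDE.curl w x‖ ^ 2)) ∧
        Tendsto (fun k => ∫ x, ∑ i, ⟪fderiv ℝ (Literature.Analysis.FluidPDE.curl (v (φ k))) x (EuclideanSpace.basisFun (Fin 3) ℝ i),
          fderiv ℝ (Literature.Analysis.FluidPDE.curl w) x (EuclideanSpace.basisFun (Fin 3) ℝ i)⟫_ℝ) atTop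
          (𝓝 (∫ x, Literature.Analysis.FluidPDE.frobeniusNormSq (fderiv ℝ (Literature.Analysis.FluidPDE.curl w) x))) ∧
        Tendsto (fun k => (∫ x, ⟪Literature.Analysis.FluidPDE.curl (v (φ k) - w) x, fderiv ℝ w x (Literature.Analysis.FluidPDE.curl w x)⟫_ℝ) +
          (∫ x, ⟪Literature.Analysis.FluidPDE.curl w x, fderiv ℝ (v (φ k) - w) x (Literature.Analysis.FluidPDE.curl w x)⟫_ℝ) +
          (∫ x, ⟪Literature.Analysis.FluidPDE.curl w x, fderiv ℝ w x (Literature.Analysis.FluidPDE.curl (v (φ k) - w) x)⟫_ℝ)) atTop (𝓝 0) ∧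
        Tendsto (fun k => (∫ x, ⟪Literature.Analysis.FluidPDE.curl (v (φ k) - w) x, fderiv ℝ (v (φ k) - w) x (Literature.Analysis.FluidPDE.curl w x)⟫_ℝ) +
          (∫ x, ⟪Literature.Analysis.FluidPDE.curl (v (φ k) - w) x, fderiv ℝ w x (Literature.Analysis.FluidPDE.curl (v (φ k) - w) x)⟫_ℝ) +
          (∫ x, ⟪Literature.Analysis.FluidPDE.curl w x, fderiv ℝ (v (φ k) - w) x (Literature.Analysis.FluidPDE.curl (v (φ k) - w) x)⟫_ℝ)) atTop (𝓝 0)) :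
    Summit.NavierStokesRegularity.NavierStokesRegularity.Theses.EfficiencyFloor.NearSaturationNearMaximiser :=
  nearSaturationNearMaximiser_of_compact fun c hsharp =>
    compact_of_centredLocalWeakLimitMixed hsharp.1 (fun f hf => hsharp.2.1 f hf) (HWm c hsharp)

end SeqCore

end NearSaturationNearMaximiser

end Summit.NavierStokesRegularity.NavierStokesRegularity.Theorems

end
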